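import Literature.NumberTheory.Automorphic.Liu2021.AppendixC.EtaleH1Tower
import Literature.NumberTheory.Automorphic.Liu2021.AppendixC.HeckeTranslates
import Literature.AlgebraicGeometry.Motives.AbelianVarietyBaseChange
import Literature.AlgebraicGeometry.HodgeTheory.AlgebraicClasses
import HarnessLib

/-!
# [Liu 2021, §4.3 l. 2154–2160] the Betti–étale comparison for `H¹` of the Albanese tower, with the Hecke action INDUCED by
# the Hecke translates — the named fact «`StubEtaleModel`» of the cell hodgecm-mathlib (a3-liu418 v3), over the REAL carriers
# of `EtaleH1Tower` and `HeckeTranslates`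

Topic `NumberTheory/Automorphic/Liu2021/AppendixC`; namespace `Literature.NumberTheory.Automorphic.Liu2021.AppendixC`.
Continuation of `EtaleH1Tower.lean` (p592872: `C.etaleH1 ℓ K = (V_ℓ A_K)^∨`, `C.etaleH1Tower ℓ`, `C.toTower ℓ K`, `C.towerRep ℓ`,
the POSITED `C.EtaleHeckeDatum ℓ` and the HYPOTHESIS structure `C.BettiComparison ℓ X H rhoB ι`) and of `HeckeTranslates.lean`
(`T : C.HeckeTranslates`, `T.albTr g K K' h : A_K ⟶ A_{K'}` = `Alb(T_g)` for `g⁻¹Kg ⊆ K'`).  Director ruling 2026-08-28T01:44:41Z: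
«`StubEtaleModel` = “∃ X : ℭ_V.EtaleHeckeDatum ℓ with Betti comparison at the pin” is an EXISTENCE statement nobody can construct
without étale cohomology ⇒ it must enter as a NAMED FACT over the VI-2′ carriers».  This file states that fact HONESTLY, i.e. with
both sides PINNED so that it has a true reading (no free existential over a posited action):

* §1 `EtaleHeckeDatum.IsInducedBy X T` — the Hecke action on `H¹_ét(A_∞)` IS the one «provided by the Hecke correspondences»
  (l. 2074): level by level, `g` acts by pull-back along `Alb(T_g) : A_K → A_{K'}` (`(V_ℓ Alb(T_g))^∨`), for every admissible pair
  `g⁻¹Kg ⊆ K'`.  (Determines `X.rhoEt` uniquely: the `C.toTower ℓ K` jointly exhaust the colimit.)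
* §2 the REAL Betti side at each level: `bettiH1Along A τ' = H¹((A ×_{E,τ'} ℂ)(ℂ); ℂ)` for an abelian variety `A / E` and an
  embedding `τ' : E →+* ℂ` (the tree's `HodgeTheory.complexBetti` of the base change `A.baseChange ℂ` along `τ'`), with the pull-back
  `bettiPullAlong τ' f` along homomorphisms `f : A ⟶ B` over `E` (singular cohomology of `AlgPoints.mapContinuous`).
* §3 `H1ComparisonFamily τ' ℓ ι` — THE COMPARISON THEOREM's content for `H¹` of abelian varieties over `E ⊆_{τ'} ℂ`, as a
  structure (data a consumer may be handed): for every `A / E` an `ι`-semilinear BIJECTION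
  `H¹((A ×_{E,τ'} ℂ)(ℂ); ℂ) → ℚ_ℓ^{ac} ⊗_{ℚ_ℓ} (V_ℓ A)^∨`, NATURAL in all homomorphisms `A ⟶ B` over `E`
  (Artin's comparison `H¹_B(X_ℂ^{an}, ℤ) ⊗ ℤ_ℓ ≅ H¹_ét(X_{\bar E}, ℤ_ℓ)` [SGA4Tome3, Exp. XI Thm. 4.4; DeligneSGA4half1977 Arcata V Thm. 3.1], for `H¹` of
  abelian varieties = `T_ℓ(A) ≅ H_1(A(ℂ), ℤ) ⊗ ℤ_ℓ` dualised [Lang1982AbelianFunctions, Ch. VII §1–2 p. 115; MumfordAV1970, §24] — over `ℂ` the tree's PROVED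
  `HodgeTheory.tateModuleComparison` / `hOneToTateModule` (`AbelianVarietyTateModuleComparison.lean` :192/:213); the passage
  `T_ℓ(A_{\bar E}) ≅ T_ℓ(A_ℂ)` along an extension `\tilde τ'` of `τ'` to `\bar E` is the leg «VI-2″», STATUS 2026-08-28T01:47:33Z;
  [Deligne1982, §1] writes the same isomorphisms `H_σ(X) ⊗ ℚ_ℓ ≅ H_ℓ(X)`), and the named fact `exists_h1ComparisonFamily`
  (`Nonempty`), debt +1 — a statement about REAL objects only (abelian varieties over a number field, their complex points, their
  Tate modules), with a TRUE universal closure.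
* §4 `Sec42Data.BettiPinning C T τ' H rhoB` — HYPOTHESIS structure (debt 0) by which a consumer PINS its own Betti tower
  `(H, rhoB)` (at the pin: the model's `H¹_{B,τ'}(A_∞, ℂ)` with its Hecke action) to the real levels: injective level maps
  `b K : H¹((A_K ×_{τ'} ℂ)(ℂ); ℂ) → H`, jointly exhaustive, intertwining pull-back along `Alb(T_g)` with `rhoB g` (for `g = 1`:
  compatible with the transition maps) — «`H¹_{B,τ'}(A_∞, ℂ) := colim_K H¹_{B,τ'}(A_K, ℂ)`» (l. 2079) with «the Hecke
  correspondences provide a homomorphism `𝔾(𝔸_F^∞) → Aut_E(A_∞)`» (l. 2074).  The consumer discharges it at the pin (kernel; its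
  junction, cf. [Liu2021] Lemma 2.4 (1), tree `albanese_bettiOne_pullback_bijective`).
* §5 THE NAMED FACT **`Sec42Data.exists_etaleHeckeDatum_with_bettiComparison C T ℓ τ' ι H rhoB B`** (debt +1): there are
  `X : C.EtaleHeckeDatum ℓ` INDUCED BY `T`, a comparison `cmp : C.BettiComparison ℓ X H rhoB ι`, and a comparison family `c` as in §3,
  such that `cmp ∘ b_K = (1 ⊗ toTower_K) ∘ c_{A_K}` for every level `K` — i.e. «we have a canonical isomorphism
  `H¹_ét(A_∞ ⊗_{E,τ'} ℂ, ℚ_ℓ^{ac}) ⊗_{ℚ_ℓ^{ac}, ι_ℓ^{-1}} ℂ ≃ H¹_{B,τ'}(A_∞, ℂ)`» (l. 2154; Thm. 4.15 proof l. 2188–2192), «a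
  `ℚ_ℓ^{ac}[Gal(ℂ/τ'(E)) × 𝔾(𝔸_F^∞)]`-module» (l. 2160), IN THE COLIMIT and compatibly with the levels.  READ HONESTLY: the
  `∃ X` part asserts, beyond §3, that the induced action is SMOOTH (`T_k = 𝟙`, `HeckeTranslates.tr_self`) and LEVEL-COMPATIBLE
  (`EtaleHeckeDatum.levelCompat`: `H¹_ét(A_K) → H¹_ét(A_∞)` injective with image the `K`-invariants for small `K` — for the REAL
  tower this is «`Alb_u` is surjective» + Galois descent along the étale covers `X_{K'} → X_K`, [Liu2021] l. 2239 «`Ω(μ)^K ≃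
  Hom_E(A_K, A_μ)_ℚ`» / Lemma 2.4; rows (I) `AlbTransitionEpi`, (D) `HonestIsogenyDescent` of a3-liu418).  JUNK TESTS (stated, as
  ref2 requires): the universal closure over ALL `C : Sec42Data` / `T : C.HeckeTranslates` is NOT claimed true — `Sec42Data` and
  `HeckeTranslates` posit their schemes/translates, and for a junk tower (`Alb_u` not surjective, or translates not Milne's `T(g)`)
  `levelCompat` can fail; the fact is PRINT at the pin: `C := sec42DataOf …` (the canonical-model tower of `U(V)`), `T :=` the pin's
  translates ([Milne2005ShimuraVarieties] Thm. 13.6, tree `UnitaryCanonicalModel.heckeTranslate_definedOver`), `B :=` the pin's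
  Betti pinning, `(H, rhoB) :=` the model's tower — the consumer's KEY lists these conditions (as for `Thm415Pinned`, C1–C3).

NOTHING here is an instance, a notation or a `sorry`; two named facts (`exists_h1ComparisonFamily`, debt +1, TRUE closure;
`Sec42Data.exists_etaleHeckeDatum_with_bettiComparison`, debt +1, binder-conditional), the rest definitions with bodies,
hypothesis structures and kernel lemmas.  HC_CM is NOT proved here; nothing of [Liu2021] is discharged.

## References
* [Liu2021] Y. Liu, Camb. J. Math. 9 (2021) = arXiv:2102.11518: §4.2 l. 2074 (Hecke homomorphism), l. 2079–2081 (`H¹_{B,τ'}(A_∞, ℂ)`);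
  §4.3 l. 2154–2160 (the comparison, the `Gal × 𝔾`-module); proof of Thm. 4.15 l. 2188–2192; Thm. 4.18 (1) l. 2239; Lemma 2.4 (1).
* [SGA4Tome3] M. Artin, A. Grothendieck, J.-L. Verdier, SGA 4 Tome 3, Exp. XI (Artin) Thm. 4.4 (comparison étale/classical).
* [DeligneSGA4half1977] P. Deligne, SGA 4½, «Arcata» V Thm. 3.1, (3.5) (comparison with the transcendental theory).
* [Lang1982AbelianFunctions] S. Lang, *Introduction to Algebraic and Abelian Functions*, 2nd ed. (1982), Ch. VII §1–2 p. 115 (`T_ℓ` of a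
  complex torus = `H_1 ⊗ ℤ_ℓ`; the tree's `tateModuleComparison`); [MumfordAV1970] D. Mumford, *Abelian Varieties*, §24 (context).
* [Deligne1982] P. Deligne, *Hodge cycles on abelian varieties*, LNM 900, §1 (the comparison isomorphisms `H_σ ⊗ ℚ_ℓ ≅ H_ℓ`).
* [Milne2005ShimuraVarieties] J. Milne, *Introduction to Shimura varieties*, Def. 12.10 (a), §13 p. 118, Thm. 13.6 (the translates `T(g)`).
* Tree: `AppendixC.EtaleH1Tower` (p592872), `AppendixC.HeckeTranslates`, `AppendixC.Thm415Pinned` (p593306),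
  `HodgeTheory.AbelianVarietyTateModuleComparison`, `HodgeTheory.complexBetti`, `Motives.AbelianVariety.baseChange/Hom.baseChange`.
-/

noncomputable section

open CategoryTheory NumberField
open scoped TensorProduct

namespace Literature.NumberTheory.Automorphic.Liu2021.AppendixC

open Literature.AlgebraicGeometry.Motives (AbelianVariety AlgPoints)
open Literature.AlgebraicGeometry.Motives.AbelianVariety (rationalTateModuleMap)
open Literature.AlgebraicGeometry.HodgeTheory (complexBetti)
open Literature.AlgebraicTopology.SingularHomology

/-! ## §2 The real Betti side at one level: `H¹((A ×_{E,τ'} ℂ)(ℂ); ℂ)` and its pull-backs -/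

section Betti

variable {E : Type} [Field E]

variable (E) in
/-- `ℂ` as an `E`-algebra through the embedding `τ' : E →+* ℂ` (Mathlib `RingHom.toAlgebra`), the base of `A ×_{E,τ'} ℂ`.
[cite: Liu2021, §4.2 l. 2079 («`A_K ⊗_{E,τ'} ℂ`»)] -/
abbrev algebraAlong (τ' : E →+* ℂ) : Algebra E ℂ := τ'.toAlgebra

/-- **`H¹_{B,τ'}(A, ℂ) := H¹((A ×_{E,τ'} ℂ)(ℂ); ℂ)`** — the degree-one complex Betti cohomology of an abelian variety `A / E` along
`τ' : E → ℂ`: the tree's `HodgeTheory.complexBetti` (singular cohomology of the complex points with the analytic topology) of the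
base change `A.baseChange ℂ` for the `E`-algebra structure `τ'` on `ℂ`.  REAL. [cite: Liu2021, §4.2 l. 2079] -/
abbrev bettiH1Along (A : AbelianVariety E) (τ' : E →+* ℂ) : Type :=
  letI : Algebra E ℂ := algebraAlong E τ'
  ↥(complexBetti (A.baseChange ℂ).X 1)

/-- **Pull-back `f^* : H¹_{B,τ'}(B, ℂ) → H¹_{B,τ'}(A, ℂ)`** along a homomorphism `f : A ⟶ B` of abelian varieties over `E`: singular
cohomology of the continuous map `(f ×_{τ'} ℂ)(ℂ) : (A ×_{τ'} ℂ)(ℂ) → (B ×_{τ'} ℂ)(ℂ)` (tree `AbelianVariety.Hom.baseChange`,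
`AlgPoints.mapContinuous`, `singularCohomology.map`). [cite: Liu2021, §4.2 l. 2070–2079] -/
def bettiPullAlong (τ' : E →+* ℂ) {A B : AbelianVariety E} (f : A ⟶ B) : bettiH1Along B τ' →ₗ[ℂ] bettiH1Along A τ' :=
  letI : Algebra E ℂ := algebraAlong E τ'
  (singularCohomology.map ℂ ℂ (AlgPoints.mapContinuous (AbelianVariety.Hom.baseChange ℂ f).hom.hom.hom) 1).hom

/-- unfolding of `bettiPullAlong`. [cite: Liu2021, §4.2 l. 2070–2079] -/
theorem bettiPullAlong_def (τ' : E →+* ℂ) {A B : AbelianVariety E} (f : A ⟶ B) :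
    bettiPullAlong τ' f =
      letI : Algebra E ℂ := algebraAlong E τ'
      (singularCohomology.map ℂ ℂ (AlgPoints.mapContinuous (AbelianVariety.Hom.baseChange ℂ f).hom.hom.hom) 1).hom :=
  rfl

/-! ## §3 The comparison theorem for `H¹` of abelian varieties over `E ⊆_{τ'} ℂ`, as a natural family -/

/-- **A Betti–étale comparison family in degree one along `(τ', ι)`**: for every abelian variety `A / E` an `ι`-semilinear
bijection `c_A : H¹((A ×_{E,τ'} ℂ)(ℂ); ℂ) → ℚ_ℓ^{ac} ⊗_{ℚ_ℓ} (V_ℓ A)^∨`, NATURAL in all homomorphisms `f : A ⟶ B` over `E`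
(`c_A ∘ f^*_B = (1 ⊗ (V_ℓ f)^∨) ∘ c_B`).  The CONTENT of Artin's comparison theorem for `H¹` of abelian varieties (`H¹_B ⊗ ℤ_ℓ ≅
H¹_ét`; `T_ℓ A ≅ H_1(A(ℂ), ℤ) ⊗ ℤ_ℓ`), tensored with `ℂ →_{ι} ℚ_ℓ^{ac}`; a structure of DATA (nothing asserted by it).
[cite: SGA4Tome3, Exp. XI Thm. 4.4] [cite: Lang1982AbelianFunctions, Ch. VII §2, p. 115] [cite: Deligne1982, §1] [cite: Liu2021, §4.3 l. 2154] -/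
structure H1ComparisonFamily (τ' : E →+* ℂ) (ℓ : ℕ) [Fact ℓ.Prime] (ι : ℂ ≃+* AlgebraicClosure ℚ_[ℓ]) : Type 1 where
  /-- the comparison map at `A`, `ι`-semilinear into `ℚ_ℓ^{ac} ⊗_{ℚ_ℓ} (V_ℓ A)^∨` -/
  cmp : ∀ A : AbelianVariety E,
    bettiH1Along A τ' →ₛₗ[(ι : ℂ →+* AlgebraicClosure ℚ_[ℓ])]
      AlgebraicClosure ℚ_[ℓ] ⊗[ℚ_[ℓ]] Module.Dual ℚ_[ℓ] (A.rationalTateModule ℓ)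
  /-- each comparison map is a bijection -/
  bijective : ∀ A : AbelianVariety E, Function.Bijective (cmp A)
  /-- naturality in homomorphisms over `E`: `c_A (f^* y) = (1 ⊗ (V_ℓ f)^∨) (c_B y)` -/
  natural : ∀ {A B : AbelianVariety E} (f : A ⟶ B) (y : bettiH1Along B τ'),
    cmp A (bettiPullAlong τ' f y) =
      ((rationalTateModuleMap ℓ f).dualMap).baseChange (AlgebraicClosure ℚ_[ℓ]) (cmp B y)

/-- **[SGA4 XI 4.4 / Mumford §24] the comparison theorem, degree one, abelian varieties over a number field `E ⊆_{τ'} ℂ`** — NAMED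
FACT (debt +1): a natural `ι`-semilinear comparison family `H¹((A ×_{E,τ'} ℂ)(ℂ); ℂ) ≅ ℚ_ℓ^{ac} ⊗ (V_ℓ A)^∨` EXISTS.  (Over `ℂ` the
tree PROVES `T_ℓ(A(ℂ)) ≅ T_ℓ A` — `HodgeTheory.tateModuleComparison`; the remaining leg `T_ℓ(A_{\bar E}) ≅ T_ℓ(A ×_{τ'} ℂ)` along an
extension of `τ'` to `\bar E` is the cell's row VI-2″.)  All objects REAL; the universal closure over `(E, τ', ℓ, ι)` is the theorem.
[cite: SGA4Tome3, Exp. XI Thm. 4.4] [cite: DeligneSGA4half1977, Arcata V Thm. 3.1 and (3.5)] [cite: Lang1982AbelianFunctions, Ch. VII §2, p. 115] [cite: Deligne1982, §1] -/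
def exists_h1ComparisonFamily (τ' : E →+* ℂ) (ℓ : ℕ) [Fact ℓ.Prime] (ι : ℂ ≃+* AlgebraicClosure ℚ_[ℓ]) : Prop :=
  Nonempty (H1ComparisonFamily (E := E) τ' ℓ ι)

end Betti

variable {F E : Type} [Field F] [NumberField F] [IsTotallyReal F] [Field E] [NumberField E] [Algebra F E]
  [IsTotallyComplex E] [Algebra.IsQuadraticExtension F E]
variable {P5 : PropC5Data F E} {isotropicAt : ℕ → Prop}

namespace Sec42Data

variable (C : Sec42Data P5 isotropicAt) (ℓ : ℕ) [Fact ℓ.Prime]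

/-! ## §1 The Hecke action on `H¹_ét(A_∞)` INDUCED by the Hecke translates -/

variable {C ℓ} in
/-- **`X` is induced by the translates `T`**: for every `g ∈ 𝔾(𝔸_F^∞)` and every admissible pair of levels `g⁻¹Kg ⊆ K'`
(`C5.HeckeLE g K K'`), `g` acts on the image of `H¹_ét(A_{K'})` in the colimit by PULL-BACK along `Alb(T_g) : A_K → A_{K'}`:
`X.rhoEt g [x]_{K'} = [(V_ℓ Alb(T_g))^∨ x]_K` — «the Hecke correspondences provide a homomorphism `𝔾(𝔸_F^∞) → Aut_E(A_∞)`»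
(l. 2074) read on `H¹_ét` (l. 2160).  Since the `[·]_K` exhaust `H¹_ét(A_∞)`, this PINS `X.rhoEt`.
[cite: Liu2021, §4.2 l. 2074 and §4.3 l. 2160] [cite: Milne2005ShimuraVarieties, §13 p. 118 L21–28] -/
def EtaleHeckeDatum.IsInducedBy (X : C.EtaleHeckeDatum ℓ) (T : C.HeckeTranslates) : Prop :=
  ∀ (g : C.G) (K K' : C5.SmallLevel C.S.K₀) (h : C5.HeckeLE g K K') (x : C.etaleH1 ℓ K'),
    X.rhoEt g (C.toTower ℓ K' x) = C.toTower ℓ K ((rationalTateModuleMap ℓ (T.albTr g K K' h)).dualMap x)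

variable {C ℓ} in
/-- unfolding of `IsInducedBy`. [cite: Liu2021, §4.2 l. 2074 and §4.3 l. 2160] -/
theorem EtaleHeckeDatum.isInducedBy_iff (X : C.EtaleHeckeDatum ℓ) (T : C.HeckeTranslates) :
    X.IsInducedBy T ↔ ∀ (g : C.G) (K K' : C5.SmallLevel C.S.K₀) (h : C5.HeckeLE g K K') (x : C.etaleH1 ℓ K'),
      X.rhoEt g (C.toTower ℓ K' x) = C.toTower ℓ K ((rationalTateModuleMap ℓ (T.albTr g K K' h)).dualMap x) :=
  Iff.rfl

/-- `H¹_{B,τ'}(A_K, ℂ)` at level `K` of the tower (l. 2079): `bettiH1Along (C.A K) τ'`. [cite: Liu2021, §4.2 l. 2079] -/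
abbrev bettiH1 (τ' : E →+* ℂ) (K : C5.SmallLevel C.S.K₀) : Type :=
  bettiH1Along (C.A K) τ'

/-! ## §4 The consumer's Betti pinning (hypothesis structure, debt 0) -/

/-- **Betti pinning of a tower module `(H, rhoB)`** to the real levels along `τ'` and the translates `T`: «`H¹_{B,τ'}(A_∞, ℂ) :=
colim_K H¹_{B,τ'}(A_K, ℂ)`» (l. 2079) with the Hecke action of l. 2074 — injective level maps `b_K : H¹((A_K ×_{τ'} ℂ)(ℂ); ℂ) → H`,
jointly exhaustive, with `rhoB g ∘ b_{K'} = b_K ∘ Alb(T_g)^*` for `g⁻¹Kg ⊆ K'` (at `g = 1`: compatibility with the transition maps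
`Alb_u^*`).  A HYPOTHESIS structure: the consumer supplies it for ITS `(H, rhoB)` (at the pin: the model's Betti tower); nothing is
asserted here. [cite: Liu2021, §4.2 l. 2074 and l. 2079–2081] -/
structure BettiPinning (T : C.HeckeTranslates) (τ' : E →+* ℂ) (H : Type) [AddCommGroup H] [Module ℂ H]
    (rhoB : Representation ℂ C.G H) : Type where
  /-- the level maps `H¹_{B,τ'}(A_K, ℂ) → H` -/
  b : ∀ K : C5.SmallLevel C.S.K₀, C.bettiH1 τ' K →ₗ[ℂ] H
  /-- each level map is injective -/
  b_injective : ∀ K : C5.SmallLevel C.S.K₀, Function.Injective (b K)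
  /-- the Hecke action on `H` is pull-back along `Alb(T_g)` on the levels -/
  b_hecke : ∀ (g : C.G) (K K' : C5.SmallLevel C.S.K₀) (h : C5.HeckeLE g K K') (y : C.bettiH1 τ' K'),
    rhoB g (b K' y) = b K (bettiPullAlong τ' (T.albTr g K K' h) y)
  /-- the level maps jointly exhaust `H` (`H` is the colimit) -/
  exhaust : ∀ x : H, ∃ (K : C5.SmallLevel C.S.K₀) (y : C.bettiH1 τ' K), b K y = x

namespace BettiPinning

variable {C} {T : C.HeckeTranslates} {τ' : E →+* ℂ} {H : Type} [AddCommGroup H] [Module ℂ H] {rhoB : Representation ℂ C.G H}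

/-- transition-compatibility (`g = 1`, `K ⊆ K'`): `b_{K'} = b_K ∘ Alb(T_1)^*` on `H` (the level `K'` classes are level `K` classes).
[cite: Liu2021, §4.2 l. 2070–2079] -/
theorem b_one (B : C.BettiPinning T τ' H rhoB) (K K' : C5.SmallLevel C.S.K₀) (h : C5.HeckeLE (1 : C.G) K K')
    (y : C.bettiH1 τ' K') : B.b K' y = B.b K (bettiPullAlong τ' (T.albTr 1 K K' h) y) := by
  have := B.b_hecke 1 K K' h y
  rwa [map_one, Module.End.one_apply] at this

/-- every level class is fixed by its level: `rhoB k (b_K y) = b_K y` for `k ∈ K` iff pull-back along `Alb(T_k)` fixes `y` — the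
shape in which `T_k = 𝟙` (`HeckeTranslates.tr_self`) yields smoothness of `H`. [cite: Liu2021, §4.2 l. 2081 («admissible»)] -/
theorem rhoB_apply_b_of_mem (B : C.BettiPinning T τ' H rhoB) {K : C5.SmallLevel C.S.K₀} {k : C.G} (hk : k ∈ K.1.1)
    (y : C.bettiH1 τ' K) :
    rhoB k (B.b K y) = B.b K (bettiPullAlong τ' (T.albTr k K K (C5.HeckeLE.of_mem hk)) y) :=
  B.b_hecke k K K _ y

end BettiPinning

/-! ## §5 The named fact: an étale Hecke datum induced by the translates, compared with the pinned Betti tower -/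

/-- **«`StubEtaleModel`» — [Liu2021, §4.3 l. 2154–2160] for the Albanese tower, NAMED FACT (debt +1).**  For the translates `T`, a
prime `ℓ`, an embedding `τ'`, `ι : ℂ ≃ ℚ_ℓ^{ac}`, and a Betti tower `(H, rhoB)` PINNED to the real levels by `B`: there exist an
étale Hecke datum `X` on `H¹_ét(A_∞ ⊗_E Ē, ℚ_ℓ)` INDUCED BY `T` (§1), a Hecke-equivariant `ι`-semilinear comparison bijection
`cmp : H → ℚ_ℓ^{ac} ⊗ H¹_ét(A_∞)` (`C.BettiComparison`, «we have a canonical isomorphism `H¹_ét(A_∞ ⊗_{E,τ'} ℂ, ℚ_ℓ^{ac})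
⊗_{ℚ_ℓ^{ac},ι_ℓ^{-1}} ℂ ≃ H¹_{B,τ'}(A_∞, ℂ)` … a `ℚ_ℓ^{ac}[Gal(ℂ/τ'(E)) × 𝔾(𝔸_F^∞)]`-module», l. 2154–2160), and a natural levelwise
comparison family `c` (§3), such that `cmp` IS `c` level by level: `cmp (b_K y) = (1 ⊗ [·]_K) (c_{A_K} y)`.  Beyond the comparison
theorem this asserts that the induced action is smooth and level-compatible (`EtaleHeckeDatum.smooth/levelCompat`: for the real
tower, `T_k = 𝟙`, `Alb_u` surjective and Galois descent along `X_{K'} → X_K` — rows (I)/(D) of a3-liu418).  BINDER-CONDITIONAL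
(module docstring, JUNK TESTS): print at `C := sec42DataOf …`, `T :=` the pin's translates, `B :=` the pin's pinning; the closure
over all posited `C`/`T` is not claimed.  A predicate; nothing asserted; NO PROOF.
[cite: Liu2021, §4.3 l. 2154–2160; §4.2 l. 2074, 2079–2081; Thm. 4.18 (1) l. 2239] [cite: SGA4Tome3, Exp. XI Thm. 4.4]
[cite: Lang1982AbelianFunctions, Ch. VII §2, p. 115] [cite: Milne2005ShimuraVarieties, Thm. 13.6] -/
def exists_etaleHeckeDatum_with_bettiComparison (T : C.HeckeTranslates) (τ' : E →+* ℂ)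
    (ι : ℂ ≃+* AlgebraicClosure ℚ_[ℓ]) (H : Type) [AddCommGroup H] [Module ℂ H] (rhoB : Representation ℂ C.G H)
    (B : C.BettiPinning T τ' H rhoB) : Prop :=
  ∃ (X : C.EtaleHeckeDatum ℓ) (cmp : C.BettiComparison ℓ X H rhoB ι) (c : H1ComparisonFamily (E := E) τ' ℓ ι),
    X.IsInducedBy T ∧
      ∀ (K : C5.SmallLevel C.S.K₀) (y : C.bettiH1 τ' K),
        cmp.cmp (B.b K y) = (C.toTower ℓ K).baseChange (AlgebraicClosure ℚ_[ℓ]) (c.cmp (C.A K) y)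

namespace exists_etaleHeckeDatum_with_bettiComparison

variable {C ℓ} {T : C.HeckeTranslates} {τ' : E →+* ℂ} {ι : ℂ ≃+* AlgebraicClosure ℚ_[ℓ]} {H : Type} [AddCommGroup H]
  [Module ℂ H] {rhoB : Representation ℂ C.G H} {B : C.BettiPinning T τ' H rhoB}

/-- the étale Hecke datum of the fact, induced by `T` (a choice). [cite: Liu2021, §4.3 l. 2160] -/
theorem exists_isInducedBy (h : C.exists_etaleHeckeDatum_with_bettiComparison ℓ T τ' ι H rhoB B) :
    ∃ X : C.EtaleHeckeDatum ℓ, X.IsInducedBy T ∧ Nonempty (C.BettiComparison ℓ X H rhoB ι) := by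
  obtain ⟨X, cmp, _, hX, _⟩ := h
  exact ⟨X, hX, ⟨cmp⟩⟩

/-- the fact contains the comparison theorem of §3. [cite: SGA4Tome3, Exp. XI Thm. 4.4] [cite: Liu2021, §4.3 l. 2154] -/
theorem exists_h1ComparisonFamily (h : C.exists_etaleHeckeDatum_with_bettiComparison ℓ T τ' ι H rhoB B) :
    AppendixC.exists_h1ComparisonFamily (E := E) τ' ℓ ι := by
  obtain ⟨_, _, c, _, _⟩ := h
  exact ⟨c⟩

/-- the shape `Thm415Pinned` consumes: SOME `X : C.EtaleHeckeDatum ℓ` with a Betti comparison for `(H, rhoB)` along `ι`.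
[cite: Liu2021, §4.3 l. 2154–2160; Thm. 4.15] -/
theorem exists_bettiComparison (h : C.exists_etaleHeckeDatum_with_bettiComparison ℓ T τ' ι H rhoB B) :
    ∃ X : C.EtaleHeckeDatum ℓ, Nonempty (C.BettiComparison ℓ X H rhoB ι) := by
  obtain ⟨X, hX, hc⟩ := exists_isInducedBy h
  exact ⟨X, hc⟩

end exists_etaleHeckeDatum_with_bettiComparison

end Sec42Data

end Literature.NumberTheory.Automorphic.Liu2021.AppendixC

end
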